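import Mathlib

/-!
# V3U §C definitions: the cone generators and the cone presentation (toric exit for `J₃`, every `p ≥ 3`)

(crux stmt-ResolutionOfSingularities-15640 `WildQuotients.WildQuotientResolution`, line `Sketch`,
sector `|G| = p`; programme V3U of `L/w45c/CHAIN.md` v5; the two definitions of
`L/w45c/W45cPlanSignaturesV5.lean` §C copied VERBATIM (owner res-L1-w45c-stub-4 per plan-1 RULING
v5.1 2026-08-27T02:09:03Z; consumers: stub-1's C2 `chartA_fixedPoints_eq`, stub-4's C3
`conePresentation_range_ker`, lead-1's V3U-F). [OURS · L1 W4.5c] — NOT a statement of any manuscript;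
replaces the role of no printed item.)

On the root chart `U = k[x₁,…,xₙ]` of chart a of `Bl_{(x_a, x_b²)} 𝔸ⁿ` (`ρ = X a`, `β = X b`,
`x_a = ρ²`, `x_b = ρβ`) the lifted `J₃`-action is the translation `β ↦ β + ρ`, `x_c ↦ x_c + ρβ`; its
invariants are generated by `ρ`, `N = β^p − ρ^{p−1}β`, `c′ = x_c − (β² − ρβ)/2` and the passengers, and
the invariants of the EVEN part (= chart a downstairs) by the cone generators
`P = ρ²`, `Q = ρN`, `R = N²`, `c′`, passengers — an `A₁`-cone `× 𝔸ⁿ⁻²` (`P R = Q²`).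

* `coneGens k p n a b c` — the set `{P, Q, R, c′} ∪ {passengers}` in `k[x]`.
* `conePresentation k p n a b c` — the presentation `k[y_o : o ∈ Option (Fin n)] → k[x]`,
  `none ↦ R`, `some a ↦ P`, `some b ↦ Q`, `some c ↦ c′`, `some i ↦ x_i`.
-/

-- single-problem summit: the doubled namespace component `ResolutionOfSingularities` is forced
set_option linter.dupNamespace false

noncomputable section

open MvPolynomial

namespace Summit.ResolutionOfSingularities.ResolutionOfSingularities.Theorems.WildQuotientResolution.ToricExit

/-- The cone generators `P = ρ²`, `Q = ρ N`, `R = N²`, `c′ = x_c − (β² − ρβ)/2` and the passengers,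
`N = β^p − ρ^{p−1} β` (`ρ = X a`, `β = X b`). [OURS · L1 W4.5c; `W45cPlanSignaturesV5.lean` §C verbatim] -/
def coneGens (k : Type) [Field k] (p n : ℕ) (a b c : Fin n) : Set (MvPolynomial (Fin n) k) :=
  {X a ^ 2, X a * (X b ^ p - X a ^ (p - 1) * X b), (X b ^ p - X a ^ (p - 1) * X b) ^ 2,
    X c - C (2⁻¹ : k) * (X b ^ 2 - X a * X b)} ∪ ((fun i => X i) '' {i | i ≠ a ∧ i ≠ b ∧ i ≠ c})

/-- The cone presentation: `k[y_P, y_Q, y_R, y_c, passengers] → k[x]`, indexed by `Option (Fin n)`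
(`none ↦ R = N²`, `some a ↦ P = ρ²`, `some b ↦ Q = ρN`, `some c ↦ c′`, `some i ↦ x_i`).
[OURS · L1 W4.5c; `W45cPlanSignaturesV5.lean` §C verbatim] -/
def conePresentation (k : Type) [Field k] (p n : ℕ) (a b c : Fin n) :
    MvPolynomial (Option (Fin n)) k →ₐ[k] MvPolynomial (Fin n) k :=
  MvPolynomial.aeval fun o => match o with
    | none => (X b ^ p - X a ^ (p - 1) * X b) ^ 2
    | some i => if i = a then X a ^ 2 else if i = b then X a * (X b ^ p - X a ^ (p - 1) * X b)
        else if i = c then X c - C (2⁻¹ : k) * (X b ^ 2 - X a * X b) else X i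

/-- The presentation on the variable `y_R = X none`. [folklore] -/
theorem conePresentation_X_none (k : Type) [Field k] (p n : ℕ) (a b c : Fin n) :
    conePresentation k p n a b c (X none) = (X b ^ p - X a ^ (p - 1) * X b) ^ 2 := by
  simp [conePresentation]

/-- The presentation on the variable `y_P = X (some a)`. [folklore] -/
theorem conePresentation_X_a (k : Type) [Field k] (p n : ℕ) (a b c : Fin n) :
    conePresentation k p n a b c (X (some a)) = X a ^ 2 := by
  simp [conePresentation]

/-- The presentation on the variable `y_Q = X (some b)` (`a ≠ b`). [folklore] -/
theorem conePresentation_X_b (k : Type) [Field k] (p n : ℕ) (a b c : Fin n) (hab : a ≠ b) :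
    conePresentation k p n a b c (X (some b)) = X a * (X b ^ p - X a ^ (p - 1) * X b) := by
  simp [conePresentation, hab.symm]

/-- The presentation on the variable `y_c = X (some c)` (`a ≠ c`, `b ≠ c`). [folklore] -/
theorem conePresentation_X_c (k : Type) [Field k] (p n : ℕ) (a b c : Fin n) (hac : a ≠ c)
    (hbc : b ≠ c) :
    conePresentation k p n a b c (X (some c)) = X c - C (2⁻¹ : k) * (X b ^ 2 - X a * X b) := by
  simp [conePresentation, hac.symm, hbc.symm]

/-- The presentation on a passenger variable. [folklore] -/
theorem conePresentation_X_of_ne (k : Type) [Field k] (p n : ℕ) (a b c : Fin n) (i : Fin n)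
    (hia : i ≠ a) (hib : i ≠ b) (hic : i ≠ c) :
    conePresentation k p n a b c (X (some i)) = X i := by
  simp [conePresentation, hia, hib, hic]

end Summit.ResolutionOfSingularities.ResolutionOfSingularities.Theorems.WildQuotientResolution.ToricExit

end
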